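import Summits.KontsevichZagierPeriods.Zeta5Search.Denom.TwoTaleP15Coincidence

/-!
# P15: the `p`-coincidence from two decays — the ♭ (flat) integrality input

HONEST FRAMING: systematic search; no irrationality claim unless certified.  NOTHING about `ζ(2)`
is certified here beyond the tree's facts: every measure statement below is an IMPLICATION whose
second-tale inputs `DecayT` (tree def, `Denom.TwoTaleP15Coincidence`) and `IntegralTFlat` (below)
are NOT tree theorems.

Cell pub-zeta5, fam-denom g7 (design `families/denom/P15KERNEL.md` §10.5–10.7).  The tree proves
`Denom.TwoTaleP15Coincidence.pCoincidence_eventually : DecayT c' → 31 − ivlRate 9 < c' →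
IntegralT → ∀ᶠ n, p_n = −p̂_n` with `IntegralT = (D₁₆ₙD₁₅ₙ p̂_n ∈ ℤ eventually)`.  The size /
divisibility argument there never uses that the normaliser is EXACTLY `D₁₆ₙD₁₅ₙ`: any extra
positive integer factor `E_n` of subexponential growth is harmless (`|E_n|_p ≤ 1` only helps the
divisibility by the class primes, and `e^{o(n)}` does not touch the rate budget
`ivlRate 9 − (31 − min(c, c')) > 0`).  This file records that weakening as a tree theorem:

* `IntegralTFlat` (INPUT, `@[conjecture] def`, NOT certified): there is `E : ℕ → ℕ`, `0 < E n`,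
  `E n ≤ e^{εn}` eventually for every `ε > 0`, with `E_n D₁₆ₙD₁₅ₙ p̂_n ∈ ℤ` eventually;
* `pCoincidence_eventually_flat : DecayT c' → 31 − ivlRate 9 < c' → IntegralTFlat →
  ∀ᶠ n, formP (aP15 n) (bP15 n) = −formPT (aT n) (bT n)` (PROVED);
* `zetaTwo_exponent_le_of_decayT_flat(_num)` — the measure corollaries through the tree's
  `zetaTwo_exponent_le_of_eventual_pCoincidence` (PROVED implications; inputs open);
* `integralTFlat_of_integralT : IntegralT → IntegralTFlat` (`E = 1`).

WHY THE ♭ VERSION IS THE RIGHT INTERFACE (design, `P15KERNEL.md` §10.7, exact-arithmetic evidence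
`code/denom/p15/u3/RESULTS.md`): `IntegralTFlat` follows from the PRINTED
[Zudilin2014ZetaTwo, Prop. 3] at the partner (`D₂₂ₙD₂₆ₙ p̂_n ∈ ℤ`, not yet in the tree) together
with a pure top-window valuation statement `ord_p p̂_n ≥ −[p ≤ 16n]` for the primes
`15n < p ≤ 26n + 1` — the multi-digit primes `p ≤ √(26n)` are absorbed into
`E_n = ∏_{p² ≤ 26n} p^{⌊log_p 22n⌋ + ⌊log_p 26n⌋} = e^{O(√n log n)}`.  That top-window statement
is where the genuinely new arithmetic sits (a "slice law" on values of `R̂` at half-integers,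
observed exactly in 8 second-tale families; NOT certified).  Nothing of this paragraph is used or
claimed below.

References: W. Zudilin, arXiv:1310.1526, Ann. Math. Québec 38 (2014) 101–117 [Zudilin2014ZetaTwo];
G. Rhin, C. Viola, Acta Arith. 77 (1996) 23–56 [RhinViola1996].
-/

noncomputable section

open Filter Topology Finset
open Literature.NumberTheory.Irrationality.Zudilin2014
open Literature.NumberTheory.Transcendental (zetaValue OddZeta.dvd_lcmUpto)
open Literature.NumberTheory.DiophantineApproximation.RhinViola (classPrimes)
open Summit.KontsevichZagierPeriods.Zeta5Search.TwoTaleP15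
open Summit.KontsevichZagierPeriods.Zeta5Search.Denom.TwoTaleP15Saving
open Summit.KontsevichZagierPeriods.Zeta5Search.Denom.TwoTaleP15Forms (lcmNormaliser
  lcmNormaliser_pos)
open Summit.KontsevichZagierPeriods.Zeta5Search.Denom.TwoTaleP15Coincidence

namespace Summit.KontsevichZagierPeriods.Zeta5Search.Denom.TwoTaleP15CoincidenceFlat

/-! ### The ♭ input (NOT certified) -/

/-- **INPUT U3♭ — normalised integrality of the second tale up to a subexponential factor**:
there is a positive integer sequence `E` with `E n ≤ e^{εn}` eventually for every `ε > 0` and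
`E_n · D₁₆ₙD₁₅ₙ · p̂_n ∈ ℤ` for all large `n`.  OPEN, NOT in print (print has `D₂₂ₙD₂₆ₙ p̂_n ∈ ℤ`,
[Zudilin2014ZetaTwo, Prop. 3]); implied by `IntegralT` (`E = 1`) and by (bmiss)@P15. -/
@[conjecture] def IntegralTFlat : Prop :=
  ∃ E : ℕ → ℕ, (∀ n, 0 < E n) ∧
    (∀ ε : ℝ, 0 < ε → ∀ᶠ n : ℕ in atTop, (E n : ℝ) ≤ Real.exp (ε * n)) ∧
    ∀ᶠ n : ℕ in atTop, ∃ z : ℤ, ((E n * lcmNormaliser n : ℕ) : ℚ) * formPT (aT n) (bT n) = z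

/-- `IntegralT → IntegralTFlat` (take `E = 1`). -/
theorem integralTFlat_of_integralT (h : IntegralT) : IntegralTFlat := by
  have h' : ∀ᶠ n : ℕ in atTop, ∃ z : ℤ, ((lcmNormaliser n : ℕ) : ℚ) * formPT (aT n) (bT n) = z :=
    h
  refine ⟨fun _ => 1, fun _ => one_pos, fun ε hε => ?_, ?_⟩
  · filter_upwards with n
    have : (0 : ℝ) ≤ ε * n := mul_nonneg hε.le (Nat.cast_nonneg n)
    simpa using Real.one_le_exp this
  · filter_upwards [h'] with n hn
    simpa using hn

/-! ### Divisibility at the class primes, with the extra factor -/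

/-- **Second tale at a class prime, with a fudge factor:** for a prime `p` with `26n < p²` and
`{n/p} ∈ [1/11, 2/17)`, `p² ∣ E · D₁₆ₙD₁₅ₙ · p̂_n` whenever the latter is an integer `z`
(`|E|_p ≤ 1`; the rest as in `TwoTaleP15Coincidence.sq_dvd_of_integral`). -/
theorem sq_dvd_of_integral_flat {n p E : ℕ} (hn : 1 ≤ n) (hp : p.Prime) (hp2 : 26 * n < p ^ 2)
    (h1 : (1 / 11 : ℝ) ≤ Int.fract ((n : ℝ) / p)) (h2 : Int.fract ((n : ℝ) / p) < 2 / 17) {z : ℤ}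
    (hz : ((E * lcmNormaliser n : ℕ) : ℚ) * formPT (aT n) (bT n) = z) : (p : ℤ) ^ 2 ∣ z := by
  haveI : Fact p.Prime := ⟨hp⟩
  obtain ⟨hu, hv⟩ := mod_bounds_of_fract (U₁ := 1) (U₂ := 11) (V₁ := 2) (V₂ := 17) hp.pos
    (by norm_num) (by norm_num) (by exact_mod_cast h1) (by exact_mod_cast h2)
  have hmod : n % p ≤ n := Nat.mod_le n p
  have hp15 : p ≤ 15 * n := by omega
  have hu' : (1 : ℤ) * p ≤ 11 * ((n : ℤ) % p) := by rw [← Int.natCast_mod]; exact_mod_cast hu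
  have hv' : (17 : ℤ) * ((n : ℤ) % p) < 2 * p := by rw [← Int.natCast_mod]; exact_mod_cast hv
  have hp0 : (p : ℚ) ≠ 0 := by exact_mod_cast hp.ne_zero
  have hD : ∀ m : ℕ, p ≤ m → padicNorm p ((Nat.lcmUpto m : ℕ) : ℚ) ≤ (p : ℚ) ^ (-(1 : ℤ)) := by
    intro m hm
    have hdvd : ((p ^ 1 : ℕ) : ℤ) ∣ ((Nat.lcmUpto m : ℕ) : ℤ) := by
      rw [pow_one]; exact_mod_cast OddZeta.dvd_lcmUpto hp.one_lt.le hm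
    have := (padicNorm.dvd_iff_norm_le (p := p)).1 hdvd
    simpa using this
  have hE : padicNorm p ((E : ℕ) : ℚ) ≤ 1 := by
    have := padicNorm.of_int (p := p) (E : ℤ)
    simpa using this
  have h3 := padicNorm_formPT_le (p := p) hn hp2 (e := 2) fun k _ _ => phat_ivl_9_EZ hp hu' hv' k
  have hnorm : padicNorm p (z : ℚ) ≤ (p : ℚ) ^ (-(2 : ℤ)) := by
    rw [← hz, Nat.cast_mul, lcmNormaliser, Nat.cast_mul, padicNorm.mul, padicNorm.mul,
      padicNorm.mul]
    calc padicNorm p ((E : ℕ) : ℚ) * (padicNorm p ((Nat.lcmUpto (16 * n) : ℕ) : ℚ) *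
          padicNorm p ((Nat.lcmUpto (15 * n) : ℕ) : ℚ)) * padicNorm p (formPT (aT n) (bT n))
        ≤ 1 * ((p : ℚ) ^ (-(1 : ℤ)) * (p : ℚ) ^ (-(1 : ℤ))) * (p : ℚ) ^ (2 - (2 : ℤ)) :=
          mul_le_mul (mul_le_mul hE (mul_le_mul (hD _ (by omega)) (hD _ hp15)
            (padicNorm.nonneg _) (by positivity))
            (mul_nonneg (padicNorm.nonneg _) (padicNorm.nonneg _)) zero_le_one) h3
            (padicNorm.nonneg _) (by positivity)
      _ = (p : ℚ) ^ (-(2 : ℤ)) := by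
          rw [one_mul, ← zpow_add₀ hp0, ← zpow_add₀ hp0]; norm_num
  exact_mod_cast (padicNorm.dvd_iff_norm_le (p := p) (n := 2) (z := z)).2 hnorm

/-- **Both tales at a class prime of `ivl 9`, with a fudge factor:** `p ∣ E · D₁₆ₙD₁₅ₙ p_n + z`
where `z = E · D₁₆ₙD₁₅ₙ p̂_n ∈ ℤ`. -/
theorem dvd_sum_of_mem_classPrimes_flat {n p E : ℕ} (hn : 1 ≤ n)
    (h : p ∈ classPrimes 26 primeCut (ivl 9) n) {z : ℤ}
    (hz : ((E * lcmNormaliser n : ℕ) : ℚ) * formPT (aT n) (bT n) = z) :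
    (p : ℤ) ∣ (E : ℤ) * pP15num n + z := by
  obtain ⟨hp, hp2, hu, hv⟩ := TwoTaleP15Levels.hyps_of_mem_classPrimes_ivl h
  have h1 : (1 / 11 : ℝ) ≤ Int.fract ((n : ℝ) / p) := by simpa [ivl] using hu
  have h2 : Int.fract ((n : ℝ) / p) < 2 / 17 := by simpa [ivl] using hv
  have hP := (ivl_1_left hn hp hp2 h1 (h2.trans (by norm_num))).2
  rw [pow_one] at hP
  exact dvd_add (dvd_mul_of_dvd_right hP _)
    ((dvd_pow_self (p : ℤ) two_ne_zero).trans (sq_dvd_of_integral_flat hn hp hp2 h1 h2 hz))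

/-- **`P_n = ivlProduct 9 n` divides `E · D₁₆ₙD₁₅ₙ (p_n + p̂_n)`**. -/
theorem ivlProduct_dvd_sum_flat {n E : ℕ} (hn : 1 ≤ n) {z : ℤ}
    (hz : ((E * lcmNormaliser n : ℕ) : ℚ) * formPT (aT n) (bT n) = z) :
    (ivlProduct 9 n : ℤ) ∣ (E : ℤ) * pP15num n + z := by
  rw [TwoTaleP15SavingAPI.ivlProduct_eq]
  have h : (∏ p ∈ classPrimes 26 primeCut (ivl 9) n, p) ∣ ((E : ℤ) * pP15num n + z).natAbs :=
    Finset.prod_primes_dvd _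
      (fun p hp => (TwoTaleP15Levels.hyps_of_mem_classPrimes_ivl hp).1.prime)
      (fun p hp => Int.natCast_dvd.1 (dvd_sum_of_mem_classPrimes_flat hn hp hz))
  exact Int.natCast_dvd.2 h

/-! ### The coincidence, eventually -/

/-- **`p_n = −p̂_n` for all large `n` from `DecayT c'`, `c' > 31 − ivlRate 9`, and `IntegralTFlat`
(PROVED implication; the inputs are NOT certified).**  `E_n D₁₆ₙD₁₅ₙ (p_n + p̂_n)` is an integer
multiple of `P_n` of absolute value `≤ e^{εn} D₁₆ₙD₁₅ₙ (e^{−29.10787 n} + e^{−c' n}) < P_n`. -/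
theorem pCoincidence_eventually_flat {c' : ℝ} (hDT : DecayT c') (hc' : 31 - ivlRate 9 < c')
    (hT : IntegralTFlat) :
    ∀ᶠ n : ℕ in atTop, formP (aP15 n) (bP15 n) = -formPT (aT n) (bT n) := by
  obtain ⟨E, hE0, hEg, hTI⟩ := hT
  have hW := TwoTaleWhipple.whippleP15_holds
  have hdec : ∀ᶠ n : ℕ in atTop, |(TwoTaleP15Forms.formQ n : ℝ) * zetaValue 2 -
      (TwoTaleP15Forms.formP n : ℝ)| ≤ Real.exp (-(29.10787 * n)) :=
    TwoTaleP15DecayHolds.decay_holds_sharp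
  have hDT' : ∀ᶠ n : ℕ in atTop, |(formQT (aT n) (bT n) : ℝ) * zetaValue 2 -
      (formPT (aT n) (bT n) : ℝ)| ≤ Real.exp (-(c' * n)) := hDT
  have h9 := ivlRate_nine_bounds
  set m : ℝ := min c' 29.10787 with hm_def
  have hm : 31 - ivlRate 9 < m := lt_min hc' (by linarith [h9.1])
  have hmc' : m ≤ c' := min_le_left _ _
  have hmc : m ≤ 29.10787 := min_le_right _ _
  obtain ⟨ε, hε, hgap⟩ : ∃ ε : ℝ, 0 < ε ∧ 4 * ε < m - (31 - ivlRate 9) :=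
    ⟨(m - (31 - ivlRate 9)) / 5, by linarith, by linarith⟩
  have h2 : ∀ᶠ n : ℕ in atTop, (2 : ℝ) < Real.exp (ε * n) := by
    have ht : Tendsto (fun n : ℕ => Real.exp (ε * n)) atTop atTop :=
      Real.tendsto_exp_atTop.comp (tendsto_natCast_atTop_atTop.const_mul_atTop hε)
    exact ht.eventually_gt_atTop 2
  filter_upwards [hDT', hdec, hTI, eventually_exp_le_ivlProduct hε,
    eventually_lcmNormaliser_le_exp hε, hEg ε hε, h2, eventually_ge_atTop 1] with n hrT hr hz hP
    hD hEn h2n hn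
  obtain ⟨z, hz⟩ := hz
  have hn0 : (0 : ℝ) ≤ n := Nat.cast_nonneg n
  -- Whipple: `q_n = −q̂_n`
  have hq : (TwoTaleP15Forms.formQ n : ℝ) = -(formQT (aT n) (bT n) : ℝ) := by
    have e1 : formQ (aP15 n) (bP15 n) = (TwoTaleP15Forms.formQ n : ℚ) :=
      TwoTaleP15Bridge.formQ_eq hn
    have e2 := bmissQ_of_whipple hW hn
    rw [e1] at e2
    have e3 := congrArg (fun x : ℚ => (x : ℝ)) e2
    push_cast at e3
    exact e3
  -- `|p_n + p̂_n| ≤ 2 e^{−m n}`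
  have hx : |(TwoTaleP15Forms.formP n : ℝ) + (formPT (aT n) (bT n) : ℝ)| ≤
      2 * Real.exp (-(m * n)) := by
    have e : (TwoTaleP15Forms.formP n : ℝ) + (formPT (aT n) (bT n) : ℝ) =
        -(((TwoTaleP15Forms.formQ n : ℝ) * zetaValue 2 - TwoTaleP15Forms.formP n) +
          ((formQT (aT n) (bT n) : ℝ) * zetaValue 2 - formPT (aT n) (bT n))) := by
      rw [hq]; ring
    rw [e, abs_neg]
    have i1 : Real.exp (-(29.10787 * n)) ≤ Real.exp (-(m * n)) :=
      Real.exp_le_exp.2 (neg_le_neg (mul_le_mul_of_nonneg_right hmc hn0))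
    have i2 : Real.exp (-(c' * n)) ≤ Real.exp (-(m * n)) :=
      Real.exp_le_exp.2 (neg_le_neg (mul_le_mul_of_nonneg_right hmc' hn0))
    calc _ ≤ |(TwoTaleP15Forms.formQ n : ℝ) * zetaValue 2 - TwoTaleP15Forms.formP n| +
          |(formQT (aT n) (bT n) : ℝ) * zetaValue 2 - formPT (aT n) (bT n)| := abs_add_le _ _
      _ ≤ 2 * Real.exp (-(m * n)) := by linarith
  -- the integer `E_n D₁₆ₙD₁₅ₙ (p_n + p̂_n) = E_n pP15num n + z`
  have hsumQ : (((E n : ℤ) * pP15num n + z : ℤ) : ℚ) =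
      ((E n * lcmNormaliser n : ℕ) : ℚ) * (TwoTaleP15Forms.formP n + formPT (aT n) (bT n)) := by
    rw [Int.cast_add, Int.cast_mul, ← pP15num_eq_formP hn, ← hz]; push_cast; ring
  have hsum : (((E n : ℤ) * pP15num n + z : ℤ) : ℝ) = (E n : ℝ) * (lcmNormaliser n : ℝ) *
      ((TwoTaleP15Forms.formP n : ℝ) + (formPT (aT n) (bT n) : ℝ)) := by
    have e3 := congrArg (fun x : ℚ => (x : ℝ)) hsumQ
    push_cast at e3 ⊢
    linarith
  -- size `< P_n`
  have hD0 : (0 : ℝ) < (lcmNormaliser n : ℝ) := by exact_mod_cast lcmNormaliser_pos n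
  have hE0' : (0 : ℝ) < (E n : ℝ) := by exact_mod_cast hE0 n
  have hED : (E n : ℝ) * (lcmNormaliser n : ℝ) ≤ Real.exp ((31 + 2 * ε) * n) := by
    calc (E n : ℝ) * (lcmNormaliser n : ℝ) ≤ Real.exp (ε * n) * Real.exp ((31 + ε) * n) :=
          mul_le_mul hEn hD hD0.le (Real.exp_pos _).le
      _ = Real.exp ((31 + 2 * ε) * n) := by rw [← Real.exp_add]; congr 1; ring
  have hlt : |(((E n : ℤ) * pP15num n + z : ℤ) : ℝ)| < (ivlProduct 9 n : ℝ) := by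
    rw [hsum, abs_mul, abs_of_pos (mul_pos hE0' hD0)]
    have hexp : Real.exp ((31 + 2 * ε) * n) * (2 * Real.exp (-(m * n))) <
        Real.exp ((ivlRate 9 - ε) * n) := by
      have e1 : Real.exp ((31 + 2 * ε) * n) * (2 * Real.exp (-(m * n))) =
          2 * Real.exp ((31 + 2 * ε - m) * n) := by
        rw [show (31 + 2 * ε - m) * (n : ℝ) = (31 + 2 * ε) * n + -(m * n) by ring, Real.exp_add]
        ring
      have e2 : Real.exp ((ivlRate 9 - ε) * n) =
          Real.exp ((ivlRate 9 - ε - (31 + 2 * ε - m)) * n) *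
            Real.exp ((31 + 2 * ε - m) * n) := by
        rw [← Real.exp_add]; congr 1; ring
      rw [e1, e2]
      have hpos : 0 < Real.exp ((31 + 2 * ε - m) * n) := Real.exp_pos _
      have hge : Real.exp (ε * n) ≤ Real.exp ((ivlRate 9 - ε - (31 + 2 * ε - m)) * n) :=
        Real.exp_le_exp.2 (mul_le_mul_of_nonneg_right (by linarith) hn0)
      have hg2 : 2 < Real.exp ((ivlRate 9 - ε - (31 + 2 * ε - m)) * n) :=
        lt_of_lt_of_le h2n hge
      nlinarith [mul_pos (sub_pos.2 hg2) hpos]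
    calc (E n : ℝ) * (lcmNormaliser n : ℝ) *
          |(TwoTaleP15Forms.formP n : ℝ) + (formPT (aT n) (bT n) : ℝ)|
        ≤ Real.exp ((31 + 2 * ε) * n) * (2 * Real.exp (-(m * n))) :=
          mul_le_mul hED hx (abs_nonneg _) (Real.exp_pos _).le
      _ < Real.exp ((ivlRate 9 - ε) * n) := hexp
      _ ≤ (ivlProduct 9 n : ℝ) := hP
  have hlt' : |(E n : ℤ) * pP15num n + z| < (ivlProduct 9 n : ℤ) := by exact_mod_cast hlt
  have h0 : (E n : ℤ) * pP15num n + z = 0 :=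
    Int.eq_zero_of_abs_lt_dvd (ivlProduct_dvd_sum_flat hn hz) hlt'
  -- conclude
  have hQ0 : ((E n * lcmNormaliser n : ℕ) : ℚ) *
      (TwoTaleP15Forms.formP n + formPT (aT n) (bT n)) = 0 := by
    rw [← hsumQ, h0]; simp
  have hD0' : ((E n * lcmNormaliser n : ℕ) : ℚ) ≠ 0 := by
    exact_mod_cast (Nat.mul_pos (hE0 n) (lcmNormaliser_pos n)).ne'
  have hsum0 := (mul_eq_zero.1 hQ0).resolve_left hD0'
  rw [formP_eq_formP hn]
  linarith

/-! ### The measure -/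

/-- **P15 measure from the ♭ inputs (PROVED implication; `DecayT c'`, `IntegralTFlat` are NOT
certified):** `μ(ζ(2)) ≤ 5.0499 ∧ μ(ζ(2)) ≤ 5.09541179`.  The value `5.0499` WOULD be below the
printed record `5.09541178` [Zudilin2014ZetaTwo, Thm 1]; it is NOT claimed. -/
theorem zetaTwo_exponent_le_of_decayT_flat {c' : ℝ} (hDT : DecayT c')
    (hc' : 31 - ivlRate 9 < c') (hT : IntegralTFlat) :
    ExponentLE (zetaValue 2) 5.0499 ∧ zetaTwo_irrationalityExponent_le :=
  zetaTwo_exponent_le_of_eventual_pCoincidence (pCoincidence_eventually_flat hDT hc' hT)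

/-- Numerical instance: `DecayT 28.462` (any rate above `31 − ivlRate 9 ≤ 28.4618859`; the model
value is `29.10787`) and `IntegralTFlat` give `μ(ζ(2)) ≤ 5.0499` (PROVED implication; inputs NOT
certified). -/
theorem zetaTwo_exponent_le_of_decayT_flat_num (hDT : DecayT 28.462) (hT : IntegralTFlat) :
    ExponentLE (zetaValue 2) 5.0499 ∧ zetaTwo_irrationalityExponent_le :=
  zetaTwo_exponent_le_of_decayT_flat hDT (by linarith [ivlRate_nine_bounds.1]) hT

end Summit.KontsevichZagierPeriods.Zeta5Search.Denom.TwoTaleP15CoincidenceFlat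

end
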